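import Literature.MathematicalPhysics.QuantumFieldTheory.QCDOS
import HarnessLib

/-!
# The eventual Goldstone lower bound of a lattice QCD regularisation

Vocabulary on top of `QCDOS.lean` (`QCDRegularisation`, `QCDRegularisation.scheme`,
`QCDLatticeObservable`, `qcdLatticeConnectedCorr`, `QCDScheme.HasLatticeMassGap`,
`QCDRegularisation.IsChiralAtZero`), requested 2026-08-16 by route `QuantumFields/QCD/DiagonalSpine`
(crux `ChiralTuning` and support `GoldstonePersistence`, where the clause below is inlined verbatim).

* `QCDRegularisation.HasGoldstoneBoundAt reg ε` — the EVENTUAL GOLDSTONE LOWER BOUND AT RATE `ε`: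
  there are a tuple of POSITIVE renormalised quark masses `m`, a rate `μ < ε`, a constant `c > 0`, ONE
  pair of gauge-invariant local lattice QCD observables `A, B` (any quark boxes `R, R'`), tori of
  sides `2S_k + 1 ≥ 2L_k + 1` and Euclidean-time separations `n_k ≤ S_k` with `a_k n_k → ∞`, such that
  for ALL LARGE `k`
  `c e^{−μ a_k n_k} ≤ ‖⟨A · τ_{n_k e₀} B⟩^conn_{k, 2S_k+1}‖`
  at the inverse bare coupling `β_k` and the bare masses `m_f(k) = m_crit(k) + a_k m_f / Z_m(k)` of
  `reg.scheme m 0 0` (the clause reads only `β_k, L_k, a_k, m_f(k)`, so `z = shift = 0`).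
* `QCDRegularisation.HasGoldstoneBound reg := ∀ ε > 0, reg.HasGoldstoneBoundAt ε`.

Reading. On a Euclidean time lattice the (connected) two-point function of a pair of hadron operators
behaves at large time separation like `c e^{−E t}`, `E` the energy of the lightest state the channel
excites, in lattice units (Montvay–Münster (5.93)–(5.96); the connected correlation (7.26) and its
`e^{−mt}` law (7.29)). So an EVENTUAL lower bound `c e^{−μ a_k n_k}` along physical times
`a_k n_k → ∞` says: the lightest state of the `(A, B)` channel at renormalised masses `m` has energy
`≤ μ < ε` in PHYSICAL units, uniformly in the cutoff index `k`. Asked for every `ε > 0` (at an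
`ε`-dependent positive mass tuple) this is the lattice shadow of the Goldstone pion: at zero quark
mass the pseudoscalar Goldstone bosons are exactly massless and they acquire a small mass at small
quark masses (Montvay–Münster §5.3, PCAC (5.140)); with Wilson quarks the chiral limit is the critical
line `a m_cr = a m̄(a m_cr, g; r)` of the axial-vector Ward identity (§5.3.2, (5.171)–(5.177)), onto
which `m_crit(k)` has to be tuned. The notion itself (one fixed channel, eventual lower bound along
one sequence of tori and separations) is harness bookkeeping, not a published definition.

Why a second notion next to `IsChiralAtZero`. `reg.IsChiralAtZero`
(`∀ ε > 0, ∃ m > 0, ¬ (reg.scheme m 0 0).HasLatticeMassGap ε`) negates an `∀ᶠ k` clause: it says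
only that the uniform gap bound fails FREQUENTLY in `k`, which is not stable under passing to a
subsequence of cutoffs — and the diagonal-subsequence step of the route does exactly that.
`HasGoldstoneBound` is the subsequence-stable strengthening: an explicit lower bound EVENTUALLY in
`k`; it implies `IsChiralAtZero` (`HasGoldstoneBound.isChiralAtZero`) and passes to every reindexing
`φ → ∞` of the regularisation (`HasGoldstoneBound.of_comp`, `HasGoldstoneBound.restrict`).

API.
* `QCDScheme.not_hasLatticeMassGap_of_frequently_slow_decay` — slow decay (even only frequently in
  `k`) on tori `S_k ≥ L_k` at separations `n_k ≤ S_k` with `a_k n_k → ∞` refutes the uniform lattice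
  gap at any rate `ε > μ`: the gap bound at `S = S_k`, `n = n_k` would give `c e^{(ε−μ) a_k n_k} ≤ C`
  while the left side tends to `+∞`.
* `hasGoldstoneBound_iff` — the fully unfolded clause (as inlined in the route items; `Iff.rfl`).
* `HasGoldstoneBoundAt.mono` — monotone in the rate (`ε ≤ ε'`: a bound below `ε` is a bound below
  `ε'`; "antitone" in the strength of the clause); `hasGoldstoneBound_of_tendsto` — the bound along
  any null sequence of rates suffices.
* `HasGoldstoneBoundAt.exists_not_hasLatticeMassGap`, `HasGoldstoneBound.isChiralAtZero`,
  `not_hasGoldstoneBoundAt_of_uniform_gap`.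
* `QCDRegularisation.restrict reg φ hφ` — the regularisation reindexed along `φ : ℕ → ℕ` with
  `φ → ∞` (the five data sequences composed with `φ`; `StrictMono.tendsto_atTop` for subsequences),
  `rfl` field lemmas and `restrict_scheme_mq`; stability `HasGoldstoneBoundAt.of_comp` /
  `HasGoldstoneBound.of_comp` for any `reg'` whose data are those of `reg` composed with `φ` (the
  equational shape of `DiagonalSpine.GoldstonePersistence` / `SubsequenceStability`) and
  `HasGoldstoneBound.restrict`, `HasGoldstoneBound.isChiralAtZero_restrict`.

NOT here: any claim that an honest regularisation of `N_f = 2, 3` QCD HAS the Goldstone bound — that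
is the crux `DiagonalSpine.ChiralTuning` (massless QCD gapless with `m_π → 0`, i.e. chiral symmetry
breaking with Goldstone pions: unproved).
-/

open Filter Topology

noncomputable section

namespace Literature.MathematicalPhysics.QuantumFieldTheory

variable {Nf : ℕ}

/-- Exponential bookkeeping: from `c e^{−μ x} ≤ C e^{−ε x}` conclude `c e^{(ε−μ) x} ≤ C`. [folklore] -/
theorem mul_exp_sub_mul_le_of_le {c C μ ε x : ℝ}
    (h : c * Real.exp (-(μ * x)) ≤ C * Real.exp (-(ε * x))) :
    c * Real.exp ((ε - μ) * x) ≤ C := by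
  have hmul := mul_le_mul_of_nonneg_right h (Real.exp_pos (ε * x)).le
  calc c * Real.exp ((ε - μ) * x)
        = c * Real.exp (-(μ * x)) * Real.exp (ε * x) := by
          rw [mul_assoc, ← Real.exp_add]
          congr 1
          ring_nf
    _ ≤ C * Real.exp (-(ε * x)) * Real.exp (ε * x) := hmul
    _ = C := by rw [mul_assoc, ← Real.exp_add, neg_add_cancel, Real.exp_zero, mul_one]

namespace QCDScheme

/-- **Slow decay on large tori kills the uniform lattice gap.** If `μ < ε`, `c > 0`, and along tori of
sides `2S_k + 1 ≥ 2L_k + 1` and Euclidean-time separations `n_k ≤ S_k` with `a_k n_k → ∞` the connected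
correlation of `A, B` at the scheme's couplings is FREQUENTLY at least `c e^{−μ a_k n_k}`, then the
scheme does not have the uniform lattice mass gap `ε`: the gap bound at `S = S_k`, `n = n_k` would give
`c e^{(ε−μ) a_k n_k} ≤ C` frequently, while `e^{(ε−μ) a_k n_k} → ∞`. (A lower bound `c e^{−μ t}` on a
two-point function at large Euclidean times bounds the lightest energy of the channel by `μ`:
Montvay–Münster (5.93)–(5.96).) [cite: MontvayMunster1994, §5.2.1 (5.93)–(5.96)] -/
theorem not_hasLatticeMassGap_of_frequently_slow_decay (sch : QCDScheme Nf) {ε μ c : ℝ}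
    (hμε : μ < ε) (hc : 0 < c) {R R' : ℕ} (A : QCDLatticeObservable Nf R)
    (B : QCDLatticeObservable Nf R') {S n : ℕ → ℕ} (hLS : ∀ k, sch.L k ≤ S k)
    (hnS : ∀ k, n k ≤ S k) (hdiv : Tendsto (fun k => sch.a k * n k) atTop atTop)
    (hfreq : ∃ᶠ k in atTop, c * Real.exp (-(μ * (sch.a k * n k))) ≤
      ‖qcdLatticeConnectedCorr (sch.β k) (2 * S k + 1) (fun fl => sch.mq fl k) A B (n k)‖) :
    ¬ sch.HasLatticeMassGap ε := by
  intro hgap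
  obtain ⟨C, hC⟩ := hgap R R' A B
  -- the gap bound on the torus of side `2 S_k + 1 ≥ 2 L_k + 1` at separation `n_k ≤ S_k`
  have hev : ∀ᶠ k in atTop,
      ‖qcdLatticeConnectedCorr (sch.β k) (2 * S k + 1) (fun fl => sch.mq fl k) A B (n k)‖ ≤
        C * Real.exp (-(ε * (sch.a k * n k))) :=
    hC.mono fun k hk => hk (S k) (hLS k) (n k) (hnS k)
  -- `c e^{(ε−μ) a_k n_k} → ∞`, so it eventually exceeds `C`
  have hexp : Tendsto (fun k => c * Real.exp ((ε - μ) * (sch.a k * n k))) atTop atTop :=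
    (Real.tendsto_exp_atTop.comp (hdiv.const_mul_atTop (sub_pos.2 hμε))).const_mul_atTop hc
  obtain ⟨k, hk₁, hk₂, hk₃⟩ :=
    (hfreq.and_eventually (hev.and (hexp.eventually_gt_atTop C))).exists
  exact absurd (mul_exp_sub_mul_le_of_le (hk₁.trans hk₂)) (not_le.2 hk₃)

end QCDScheme

namespace QCDRegularisation

/-- **The eventual Goldstone lower bound at rate `ε`** of a mass-independent lattice regularisation
of `N_f`-flavour QCD (harness bookkeeping for route `QuantumFields/QCD/DiagonalSpine`, the clause `G`
of its crux `ChiralTuning`): there are POSITIVE renormalised quark masses `m_f`, a rate `μ < ε`, a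
constant `c > 0`, ONE pair of gauge-invariant local lattice QCD observables `A, B` (e.g. a flavoured
pseudoscalar density and its conjugate), tori of sides `2S_k + 1 ≥ 2L_k + 1` and Euclidean-time
separations `n_k ≤ S_k` with `a_k n_k → ∞` such that EVENTUALLY in `k`
`c e^{−μ a_k n_k} ≤ ‖⟨A · τ_{n_k e₀}B⟩^conn_{k,2S_k+1}‖`, the connected correlation taken at the bare
coupling `β_k` and the bare masses `m_f(k) = m_crit(k) + a_k m_f / Z_m(k)` of `reg.scheme m 0 0`.
Reading: a two-point function bounded BELOW by `c e^{−μ t}` at large Euclidean times `t = a_k n_k`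
has a state of energy `≤ μ` in its channel (Montvay–Münster (5.93)–(5.96): `⟨B(y₄)A(x₄)⟩ ≃ c e^{−E|y₄−x₄|}`,
`E` the lowest energy the channel excites), so the lightest state of the `(A, B)` channel at masses `m`
has energy `≤ μ < ε` in physical units, uniformly in `k` — the Goldstone pion, massless at zero quark
mass and light at small quark masses (Montvay–Münster §5.3, PCAC (5.140); with Wilson quarks the chiral
limit is the critical line (5.177) of the axial Ward identity (5.171)). The tori `S_k ≥ L_k` are free
so that physical times `a_k n_k` of any growth are available.
[cite: MontvayMunster1994, §5.2.1 (5.93)–(5.96); §5.3 (5.140); §5.3.2 (5.171)–(5.177)] -/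
def HasGoldstoneBoundAt (reg : QCDRegularisation Nf) (ε : ℝ) : Prop :=
  ∃ m : Fin Nf → ℝ, (∀ f, 0 < m f) ∧ ∃ μ c : ℝ, μ < ε ∧ 0 < c ∧
    ∃ (R R' : ℕ) (A : QCDLatticeObservable Nf R) (B : QCDLatticeObservable Nf R') (S n : ℕ → ℕ),
      (∀ k, reg.L k ≤ S k) ∧ (∀ k, n k ≤ S k) ∧ Tendsto (fun k => reg.a k * n k) atTop atTop ∧
        ∀ᶠ k in atTop, c * Real.exp (-(μ * (reg.a k * n k))) ≤
          ‖qcdLatticeConnectedCorr (reg.β k) (2 * S k + 1) (fun fl => (reg.scheme m 0 0).mq fl k)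
            A B (n k)‖

/-- **The eventual Goldstone lower bound** of a mass-independent lattice regularisation of
`N_f`-flavour QCD: for EVERY rate `ε > 0` the Goldstone bound at rate `ε` (`HasGoldstoneBoundAt`) —
at some positive mass tuple the lightest state of one fixed channel has energy below `ε`, witnessed by
an eventual lower bound on one connected lattice correlation. The subsequence-stable strengthening of
`QCDRegularisation.IsChiralAtZero` ("the lattice gap closes as `m → 0⁺`"), which it implies
(`HasGoldstoneBound.isChiralAtZero`); physically the statement that the pion mass tends to zero with
the quark mass (Montvay–Münster §5.3, (5.140)). [cite: MontvayMunster1994, §5.3 (5.140) and §5.3.2 (5.177)] -/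
def HasGoldstoneBound (reg : QCDRegularisation Nf) : Prop :=
  ∀ ε > (0 : ℝ), reg.HasGoldstoneBoundAt ε

/-- `HasGoldstoneBound` fully unfolded — verbatim the clause inlined in
`DiagonalSpine.ChiralTuning` / `GoldstonePersistence` (definitional). [folklore] -/
theorem hasGoldstoneBound_iff (reg : QCDRegularisation Nf) :
    reg.HasGoldstoneBound ↔
      ∀ ε > (0 : ℝ), ∃ m : Fin Nf → ℝ, (∀ f, 0 < m f) ∧ ∃ μ c : ℝ, μ < ε ∧ 0 < c ∧
        ∃ (R R' : ℕ) (A : QCDLatticeObservable Nf R) (B : QCDLatticeObservable Nf R')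
          (S n : ℕ → ℕ), (∀ k, reg.L k ≤ S k) ∧ (∀ k, n k ≤ S k) ∧
            Tendsto (fun k => reg.a k * n k) atTop atTop ∧
              ∀ᶠ k in atTop, c * Real.exp (-(μ * (reg.a k * n k))) ≤
                ‖qcdLatticeConnectedCorr (reg.β k) (2 * S k + 1)
                  (fun fl => (reg.scheme m 0 0).mq fl k) A B (n k)‖ :=
  Iff.rfl

/-- A regularisation with the Goldstone bound has it at every positive rate. [folklore] -/
theorem HasGoldstoneBound.hasGoldstoneBoundAt {reg : QCDRegularisation Nf}
    (h : reg.HasGoldstoneBound) {ε : ℝ} (hε : 0 < ε) : reg.HasGoldstoneBoundAt ε :=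
  h ε hε

/-- **Monotonicity in the rate**: a Goldstone bound at rate `ε` is one at every rate `ε' ≥ ε` (the
same witnesses, `μ < ε ≤ ε'`); equivalently the clause gets STRONGER as `ε ↓ 0`. [folklore] -/
theorem HasGoldstoneBoundAt.mono {reg : QCDRegularisation Nf} {ε ε' : ℝ}
    (h : reg.HasGoldstoneBoundAt ε) (hle : ε ≤ ε') : reg.HasGoldstoneBoundAt ε' := by
  obtain ⟨m, hm, μ, c, hμ, hc, hrest⟩ := h
  exact ⟨m, hm, μ, c, hμ.trans_le hle, hc, hrest⟩

/-- **A null sequence of rates suffices**: if the Goldstone bound holds at rates `u_j → 0`, it holds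
at every `ε > 0` (some `u_j < ε`, then monotonicity). [folklore] -/
theorem hasGoldstoneBound_of_tendsto {reg : QCDRegularisation Nf} {u : ℕ → ℝ}
    (hu : Tendsto u atTop (𝓝 0)) (h : ∀ j, reg.HasGoldstoneBoundAt (u j)) :
    reg.HasGoldstoneBound := fun ε hε => by
  obtain ⟨j, hj⟩ := (hu.eventually (eventually_lt_nhds hε)).exists
  exact (h j).mono hj.le

/-- **The Goldstone bound at rate `ε` refutes the uniform lattice gap `ε`** at its mass tuple (the
eventual lower bound is in particular a frequent one; `QCDScheme.not_hasLatticeMassGap_of_frequently_slow_decay`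
at the scheme `reg.scheme m 0 0`, whose `a, β, L` are those of `reg`). [folklore] -/
theorem HasGoldstoneBoundAt.exists_not_hasLatticeMassGap {reg : QCDRegularisation Nf} {ε : ℝ}
    (h : reg.HasGoldstoneBoundAt ε) :
    ∃ m : Fin Nf → ℝ, (∀ f, 0 < m f) ∧ ¬ (reg.scheme m 0 0).HasLatticeMassGap ε := by
  obtain ⟨m, hm, μ, c, hμ, hc, R, R', A, B, S, n, hLS, hnS, hdiv, hev⟩ := h
  exact ⟨m, hm, (reg.scheme m 0 0).not_hasLatticeMassGap_of_frequently_slow_decay hμ hc A B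
    hLS hnS hdiv hev.frequently⟩

/-- **The Goldstone bound implies chirality at zero** (`IsChiralAtZero`, the conjunct of `QCDOf`):
for every `ε > 0` the bound at rate `ε` exhibits positive masses without the uniform lattice gap `ε`.
[folklore] -/
theorem HasGoldstoneBound.isChiralAtZero {reg : QCDRegularisation Nf} (h : reg.HasGoldstoneBound) :
    reg.IsChiralAtZero :=
  fun ε hε => (h ε hε).exists_not_hasLatticeMassGap

/-- **A uniform gap at all positive mass tuples refutes the Goldstone bound at that rate.** [folklore] -/
theorem not_hasGoldstoneBoundAt_of_uniform_gap {reg : QCDRegularisation Nf} {ε : ℝ}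
    (h : ∀ m : Fin Nf → ℝ, (∀ f, 0 < m f) → (reg.scheme m 0 0).HasLatticeMassGap ε) :
    ¬ reg.HasGoldstoneBoundAt ε := fun hG => by
  obtain ⟨m, hm, hng⟩ := hG.exists_not_hasLatticeMassGap
  exact hng (h m hm)

/-- **The regularisation reindexed along `φ : ℕ → ℕ`, `φ → ∞`** (e.g. restricted to a subsequence,
`StrictMono.tendsto_atTop`): all five data sequences `a, β, L, m_crit, Z_m` composed with `φ`;
`a ∘ φ → 0` and `(a L) ∘ φ → ∞` because `φ → ∞`. The shape of `DiagonalSpine.SubsequenceStability` /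
`GoldstonePersistence`. [folklore] -/
def restrict (reg : QCDRegularisation Nf) (φ : ℕ → ℕ) (hφ : Tendsto φ atTop atTop) :
    QCDRegularisation Nf where
  a := reg.a ∘ φ
  a_pos k := reg.a_pos (φ k)
  tendsto_a := reg.tendsto_a.comp hφ
  β := reg.β ∘ φ
  L := reg.L ∘ φ
  tendsto_L := reg.tendsto_L.comp hφ
  mcrit := reg.mcrit ∘ φ
  Zm := reg.Zm ∘ φ
  Zm_pos k := reg.Zm_pos (φ k)

section restrict

variable (reg : QCDRegularisation Nf) (φ : ℕ → ℕ) (hφ : Tendsto φ atTop atTop)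

/-- The spacings of the reindexed regularisation. [folklore] -/
@[simp] theorem restrict_a : (reg.restrict φ hφ).a = reg.a ∘ φ := rfl

/-- The couplings of the reindexed regularisation. [folklore] -/
@[simp] theorem restrict_β : (reg.restrict φ hφ).β = reg.β ∘ φ := rfl

/-- The volumes of the reindexed regularisation. [folklore] -/
@[simp] theorem restrict_L : (reg.restrict φ hφ).L = reg.L ∘ φ := rfl

/-- The critical masses of the reindexed regularisation. [folklore] -/
@[simp] theorem restrict_mcrit : (reg.restrict φ hφ).mcrit = reg.mcrit ∘ φ := rfl

/-- The mass renormalisations of the reindexed regularisation. [folklore] -/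
@[simp] theorem restrict_Zm : (reg.restrict φ hφ).Zm = reg.Zm ∘ φ := rfl

/-- The bare-mass trajectories of the reindexed regularisation are the reindexed trajectories. [folklore] -/
@[simp] theorem restrict_scheme_mq (m : Fin Nf → ℝ) (z shift : QCDField Nf → ℕ → ℝ) (f : Fin Nf)
    (k : ℕ) : ((reg.restrict φ hφ).scheme m z shift).mq f k = (reg.scheme m z shift).mq f (φ k) :=
  rfl

end restrict

/-- **Stability of the Goldstone bound under reindexing** (equational form, the hypotheses of
`DiagonalSpine.GoldstonePersistence`): if the data of `reg'` are those of `reg` composed with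
`φ → ∞`, a Goldstone bound of `reg` at rate `ε` is one of `reg'` — same masses, rate, constant and
observables, tori `S ∘ φ` and separations `n ∘ φ`; `Tendsto`/`∀ᶠ` along `atTop` compose with `φ`.
[folklore] -/
theorem HasGoldstoneBoundAt.of_comp {reg reg' : QCDRegularisation Nf} {φ : ℕ → ℕ}
    (hφ : Tendsto φ atTop atTop) (ha : reg'.a = reg.a ∘ φ) (hβ : reg'.β = reg.β ∘ φ)
    (hL : reg'.L = reg.L ∘ φ) (hmcrit : reg'.mcrit = reg.mcrit ∘ φ) (hZm : reg'.Zm = reg.Zm ∘ φ)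
    {ε : ℝ} (h : reg.HasGoldstoneBoundAt ε) : reg'.HasGoldstoneBoundAt ε := by
  obtain ⟨m, hm, μ, c, hμ, hc, R, R', A, B, S, n, hLS, hnS, hdiv, hev⟩ := h
  refine ⟨m, hm, μ, c, hμ, hc, R, R', A, B, fun k => S (φ k), fun k => n (φ k), fun k => ?_,
    fun k => hnS (φ k), ?_, ?_⟩
  · rw [hL]
    exact hLS (φ k)
  · rw [ha]
    exact hdiv.comp hφ
  · refine (hφ.eventually hev).mono fun k hk => ?_
    simpa only [scheme_mq, ha, hβ, hmcrit, hZm, Function.comp_apply] using hk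

/-- **Stability of the Goldstone bound under reindexing** (all rates). [folklore] -/
theorem HasGoldstoneBound.of_comp {reg reg' : QCDRegularisation Nf} {φ : ℕ → ℕ}
    (hφ : Tendsto φ atTop atTop) (ha : reg'.a = reg.a ∘ φ) (hβ : reg'.β = reg.β ∘ φ)
    (hL : reg'.L = reg.L ∘ φ) (hmcrit : reg'.mcrit = reg.mcrit ∘ φ) (hZm : reg'.Zm = reg.Zm ∘ φ)
    (h : reg.HasGoldstoneBound) : reg'.HasGoldstoneBound :=
  fun ε hε => (h ε hε).of_comp hφ ha hβ hL hmcrit hZm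

/-- The Goldstone bound passes to `reg.restrict φ hφ`. [folklore] -/
theorem HasGoldstoneBound.restrict {reg : QCDRegularisation Nf} (h : reg.HasGoldstoneBound)
    (φ : ℕ → ℕ) (hφ : Tendsto φ atTop atTop) : (reg.restrict φ hφ).HasGoldstoneBound :=
  h.of_comp hφ rfl rfl rfl rfl rfl

/-- Every reindexing of a regularisation with the Goldstone bound is chiral at zero — the point of
the notion: `IsChiralAtZero` itself is not inherited by subsequences. [folklore] -/
theorem HasGoldstoneBound.isChiralAtZero_restrict {reg : QCDRegularisation Nf}
    (h : reg.HasGoldstoneBound) (φ : ℕ → ℕ) (hφ : Tendsto φ atTop atTop) :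
    (reg.restrict φ hφ).IsChiralAtZero :=
  (h.restrict φ hφ).isChiralAtZero

end QCDRegularisation

end Literature.MathematicalPhysics.QuantumFieldTheory

end
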